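import Mathlib.MeasureTheory.Integral.Bochner.Basic
import Mathlib.Analysis.InnerProductSpace.PiL2
import HarnessLib

/-!
# Window-to-cone step of `ParityBandClosure` — helper A: the window covariance algebra

Support file for the stub `stub_stressIsotropyOfWindowCovariance` of the line `transfer-weighted-parity-chain`
(skeleton v4) of the crux `JParityClosure.ParityBandClosure` (stmt-AtomisticToContinuum-17608).

WHAT.  Abstract, deterministic algebra of ONE space–time window.  On a measure space `(α, μ)` (in the
application: the time window `[0, τ]` with Lebesgue measure) we are given a nonnegative integrable "mass
profile" `R` (in the application `s ↦ bt(s − t₀) ρ_r(s, x₀)`), "momentum profiles" `M j` vanishing where `R`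
does (`bt · m_r`), and "second-moment profiles" `E j k` (`bt · M_r`).  The WINDOW quantities are
`R̄ = ∫R`, `M̄ⱼ = ∫Mⱼ`, `Ēⱼₖ = ∫Eⱼₖ`, the window covariance `C_w = Ē − M̄⊗M̄/R̄` (the `Cw` of
`WindowCovarianceIsotropy`) and the bulk-velocity fluctuation `D_w = ∫ M⊗M/R − M̄⊗M̄/R̄`.  We prove:

* `integral_stress_eq` — the EXACT window-to-cone identity `∫ (Eⱼₖ − MⱼMₖ/R) = C_w jk − D_w jk`;
* `sq_integral_le` — the weighted Cauchy–Schwarz inequality `(∫f)² ≤ (∫R)(∫ f²/R)` for `f` vanishing on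
  `{R = 0}` (Lean's `x/0 = 0` makes every junk branch harmless), whence `quadForm_fluct_nonneg`: `D_w ⪰ 0`;
* `abs_offDiag_le`, `sum_abs_le_three_mul_trace` — `|D_jk| ≤ (D_jj + D_kk)/2`, `Σ|D_jk| ≤ 3 tr D` for a
  positive semidefinite symmetric `3 × 3` array;
* `fluct_diag_le` — `D_jj ≤ ∫ (Mⱼ − cⱼR)²/R` for EVERY centre `c` (variance ≤ second moment about `c`);
* `traceless_contraction_eq`, `abs_traceless_contraction_le` — for a traceless `a`,
  `Σ aⱼₖ Cⱼₖ = Σ aⱼₖ (Cⱼₖ − δⱼₖ tr C/3)`, so `|a : C| ≤ ‖a‖_∞ · dev C` with `dev` EXACTLY the deviator norm of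
  `WindowCovarianceIsotropy`.

All statements are elementary real analysis; no fact of the line is used.

REFERENCES.  Standard (weighted Cauchy–Schwarz / variance algebra); the role of `D_w` is explained in the
skeleton `Cruxes/ParityBandClosure/Lines/TransferWeightedParityChain.lean`, header (A).
-/

noncomputable section

namespace Summit.AtomisticToContinuum.HydrodynamicLimit.Theorems.ParityBandClosureWindowToCone

open scoped BigOperators
open MeasureTheory

variable {α : Type*} [MeasurableSpace α] {μ : Measure α}

/-! ## §1 Pointwise expansions with Lean's `x / 0 = 0` -/

/-- `(f − cR)²/R = f²/R − 2cf + c²R` whenever `R ≥ 0` and `f = 0` where `R = 0` (both sides vanish on the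
junk branch). [folklore] -/
theorem sq_sub_div_eq {f R c : ℝ} (hR : 0 ≤ R) (h0 : R = 0 → f = 0) :
    (f - c * R) ^ 2 / R = f ^ 2 / R - 2 * c * f + c ^ 2 * R := by
  rcases hR.eq_or_lt with h | h
  · have hf : f = 0 := h0 h.symm
    rw [← h, hf]; simp
  · field_simp
    ring

/-- `f g / R` with `f = Σ ξⱼ Mⱼ`: `(Σⱼ ξⱼMⱼ)(Σₖ ξₖMₖ)/R = Σⱼₖ ξⱼξₖ (MⱼMₖ/R)`. [folklore] -/
theorem sum_mul_sum_div_eq (ξ M : Fin 3 → ℝ) (R : ℝ) :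
    (∑ j, ξ j * M j) * (∑ k, ξ k * M k) / R = ∑ j, ∑ k, ξ j * ξ k * (M j * M k / R) := by
  rw [Finset.sum_mul_sum, Finset.sum_div]
  refine Finset.sum_congr rfl fun j _ => ?_
  rw [Finset.sum_div]
  refine Finset.sum_congr rfl fun k _ => ?_
  ring

/-! ## §2 The weighted Cauchy–Schwarz inequality -/

/-- **Weighted Cauchy–Schwarz with a vanishing constraint**: if `R ≥ 0`, `f = 0` on `{R = 0}` and `R`, `f`,
`f²/R` are integrable, then `(∫f)² ≤ (∫R) · ∫ f²/R`.  Proof: with `l = ∫f/∫R`,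
`0 ≤ ∫ (f − lR)²/R = ∫f²/R − (∫f)²/∫R`; if `∫R = 0` then `R = 0` a.e., so `f = 0` a.e. [folklore] -/
theorem sq_integral_le {f R : α → ℝ} (hR : ∀ a, 0 ≤ R a) (h0 : ∀ a, R a = 0 → f a = 0)
    (hRi : Integrable R μ) (hfi : Integrable f μ) (hf2 : Integrable (fun a => f a ^ 2 / R a) μ) :
    (∫ a, f a ∂μ) ^ 2 ≤ (∫ a, R a ∂μ) * ∫ a, f a ^ 2 / R a ∂μ := by
  by_cases hR0 : ∫ a, R a ∂μ = 0
  · have hae : R =ᵐ[μ] 0 := (integral_eq_zero_iff_of_nonneg (fun a => hR a) hRi).1 hR0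
    have hfae : f =ᵐ[μ] 0 := hae.mono fun a ha => h0 a ha
    rw [integral_eq_zero_of_ae hfae, hR0]
    simp
  · have hRpos : 0 < ∫ a, R a ∂μ := lt_of_le_of_ne (integral_nonneg hR) (Ne.symm hR0)
    set l : ℝ := (∫ a, f a ∂μ) / ∫ a, R a ∂μ with hl
    have hpt : ∀ a, (f a - l * R a) ^ 2 / R a = f a ^ 2 / R a - 2 * l * f a + l ^ 2 * R a :=
      fun a => sq_sub_div_eq (hR a) (h0 a)
    have hnn : 0 ≤ ∫ a, (f a - l * R a) ^ 2 / R a ∂μ :=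
      integral_nonneg fun a => div_nonneg (sq_nonneg _) (hR a)
    have heq : ∫ a, (f a - l * R a) ^ 2 / R a ∂μ =
        (∫ a, f a ^ 2 / R a ∂μ) - 2 * l * (∫ a, f a ∂μ) + l ^ 2 * ∫ a, R a ∂μ := by
      simp_rw [hpt]
      have h1 : Integrable (fun a => f a ^ 2 / R a - 2 * l * f a) μ := hf2.sub (hfi.const_mul _)
      have h2 : Integrable (fun a => l ^ 2 * R a) μ := hRi.const_mul _
      have h3 : Integrable (fun a => 2 * l * f a) μ := hfi.const_mul _
      rw [integral_add h1 h2, integral_sub hf2 h3, integral_const_mul, integral_const_mul]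
    rw [heq] at hnn
    have hl' : l * ∫ a, R a ∂μ = ∫ a, f a ∂μ := by
      rw [hl, div_mul_cancel₀ _ hR0]
    nlinarith [hl', hnn, hRpos]

/-- Division form of the weighted Cauchy–Schwarz inequality: `(∫f)²/∫R ≤ ∫ f²/R` (junk branch included).
[folklore] -/
theorem sq_integral_div_le {f R : α → ℝ} (hR : ∀ a, 0 ≤ R a) (h0 : ∀ a, R a = 0 → f a = 0)
    (hRi : Integrable R μ) (hfi : Integrable f μ) (hf2 : Integrable (fun a => f a ^ 2 / R a) μ) :
    (∫ a, f a ∂μ) ^ 2 / (∫ a, R a ∂μ) ≤ ∫ a, f a ^ 2 / R a ∂μ := by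
  have h := sq_integral_le hR h0 hRi hfi hf2
  have hnn : 0 ≤ ∫ a, f a ^ 2 / R a ∂μ := integral_nonneg fun a => div_nonneg (sq_nonneg _) (hR a)
  by_cases hR0 : ∫ a, R a ∂μ = 0
  · rw [hR0, div_zero]; exact hnn
  · have hRpos : 0 < ∫ a, R a ∂μ := lt_of_le_of_ne (integral_nonneg hR) (Ne.symm hR0)
    rw [div_le_iff₀ hRpos, mul_comm]
    exact h

/-! ## §3 The bulk-velocity fluctuation `D_w` is positive semidefinite -/

section Fluct

variable {R : α → ℝ} {M : Fin 3 → α → ℝ}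

/-- **`D_w ⪰ 0`**: for every `ξ`, `0 ≤ Σⱼₖ ξⱼξₖ (∫ MⱼMₖ/R − M̄ⱼM̄ₖ/R̄)` — the weighted Cauchy–Schwarz inequality
applied to `f = Σ ξⱼMⱼ`. [folklore] -/
theorem quadForm_fluct_nonneg (hR : ∀ a, 0 ≤ R a) (h0 : ∀ j a, R a = 0 → M j a = 0) (hRi : Integrable R μ)
    (hMi : ∀ j, Integrable (M j) μ) (hMMi : ∀ j k, Integrable (fun a => M j a * M k a / R a) μ)
    (ξ : Fin 3 → ℝ) :
    0 ≤ ∑ j, ∑ k, ξ j * ξ k *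
      ((∫ a, M j a * M k a / R a ∂μ) - (∫ a, M j a ∂μ) * (∫ a, M k a ∂μ) / ∫ a, R a ∂μ) := by
  set f : α → ℝ := fun a => ∑ j, ξ j * M j a with hf
  have hfi : Integrable f μ := integrable_finsetSum _ fun j _ => (hMi j).const_mul _
  have hf0 : ∀ a, R a = 0 → f a = 0 := fun a ha => by
    simp only [hf]
    exact Finset.sum_eq_zero fun j _ => by rw [h0 j a ha, mul_zero]
  have hf2eq : ∀ a, f a ^ 2 / R a = ∑ j, ∑ k, ξ j * ξ k * (M j a * M k a / R a) := fun a => by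
    rw [sq]; exact sum_mul_sum_div_eq ξ (fun j => M j a) (R a)
  have hf2i : Integrable (fun a => f a ^ 2 / R a) μ := by
    have : (fun a => f a ^ 2 / R a) = fun a => ∑ j, ∑ k, ξ j * ξ k * (M j a * M k a / R a) := funext hf2eq
    rw [this]
    exact integrable_finsetSum _ fun j _ => integrable_finsetSum _ fun k _ => (hMMi j k).const_mul _
  have hCS := sq_integral_div_le hR hf0 hRi hfi hf2i
  have hI1 : ∫ a, f a ∂μ = ∑ j, ξ j * ∫ a, M j a ∂μ := by
    simp only [hf]
    rw [integral_finsetSum _ fun j _ => (hMi j).const_mul _]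
    exact Finset.sum_congr rfl fun j _ => integral_const_mul _ _
  have hI2 : ∫ a, f a ^ 2 / R a ∂μ = ∑ j, ∑ k, ξ j * ξ k * ∫ a, M j a * M k a / R a ∂μ := by
    simp_rw [hf2eq]
    rw [integral_finsetSum _ fun j _ => integrable_finsetSum _ fun k _ => (hMMi j k).const_mul _]
    refine Finset.sum_congr rfl fun j _ => ?_
    rw [integral_finsetSum _ fun k _ => (hMMi j k).const_mul _]
    exact Finset.sum_congr rfl fun k _ => integral_const_mul _ _
  have hI3 : (∫ a, f a ∂μ) ^ 2 / (∫ a, R a ∂μ) =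
      ∑ j, ∑ k, ξ j * ξ k * ((∫ a, M j a ∂μ) * (∫ a, M k a ∂μ) / ∫ a, R a ∂μ) := by
    rw [hI1, sq]; exact sum_mul_sum_div_eq ξ (fun j => ∫ a, M j a ∂μ) _
  rw [hI2, hI3] at hCS
  have : ∑ j, ∑ k, ξ j * ξ k *
      ((∫ a, M j a * M k a / R a ∂μ) - (∫ a, M j a ∂μ) * (∫ a, M k a ∂μ) / ∫ a, R a ∂μ) =
      (∑ j, ∑ k, ξ j * ξ k * ∫ a, M j a * M k a / R a ∂μ) -
        ∑ j, ∑ k, ξ j * ξ k * ((∫ a, M j a ∂μ) * (∫ a, M k a ∂μ) / ∫ a, R a ∂μ) := by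
    rw [← Finset.sum_sub_distrib]
    refine Finset.sum_congr rfl fun j _ => ?_
    rw [← Finset.sum_sub_distrib]
    refine Finset.sum_congr rfl fun k _ => ?_
    ring
  rw [this]
  linarith

/-- **Variance ≤ second moment about any centre**: `D_jj ≤ ∫ (Mⱼ − cR)²/R` for every real `c`.
[folklore] -/
theorem fluct_diag_le (hR : ∀ a, 0 ≤ R a) (h0 : ∀ j a, R a = 0 → M j a = 0) (hRi : Integrable R μ)
    (hMi : ∀ j, Integrable (M j) μ) (hMMi : ∀ j k, Integrable (fun a => M j a * M k a / R a) μ)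
    (j : Fin 3) (c : ℝ) :
    (∫ a, M j a * M j a / R a ∂μ) - (∫ a, M j a ∂μ) * (∫ a, M j a ∂μ) / (∫ a, R a ∂μ) ≤
      ∫ a, (M j a - c * R a) ^ 2 / R a ∂μ := by
  have hpt : ∀ a, (M j a - c * R a) ^ 2 / R a = M j a ^ 2 / R a - 2 * c * M j a + c ^ 2 * R a :=
    fun a => sq_sub_div_eq (hR a) (h0 j a)
  have hsq : (fun a => M j a ^ 2 / R a) = fun a => M j a * M j a / R a := funext fun a => by rw [sq]
  have hf2 : Integrable (fun a => M j a ^ 2 / R a) μ := by rw [hsq]; exact hMMi j j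
  have heq : ∫ a, (M j a - c * R a) ^ 2 / R a ∂μ =
      (∫ a, M j a * M j a / R a ∂μ) - 2 * c * (∫ a, M j a ∂μ) + c ^ 2 * ∫ a, R a ∂μ := by
    simp_rw [hpt]
    have h1 : Integrable (fun a => M j a ^ 2 / R a - 2 * c * M j a) μ := hf2.sub ((hMi j).const_mul _)
    have h2 : Integrable (fun a => c ^ 2 * R a) μ := hRi.const_mul _
    have h3 : Integrable (fun a => 2 * c * M j a) μ := (hMi j).const_mul _
    rw [integral_add h1 h2, integral_sub hf2 h3, integral_const_mul, integral_const_mul, hsq]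
  rw [heq]
  by_cases hR0 : ∫ a, R a ∂μ = 0
  · have hae : R =ᵐ[μ] 0 := (integral_eq_zero_iff_of_nonneg (fun a => hR a) hRi).1 hR0
    have hfae : M j =ᵐ[μ] 0 := hae.mono fun a ha => h0 j a ha
    rw [integral_eq_zero_of_ae hfae, hR0]
    simp
  · have hRpos : 0 < ∫ a, R a ∂μ := lt_of_le_of_ne (integral_nonneg hR) (Ne.symm hR0)
    have key : 0 ≤ ((∫ a, M j a ∂μ) - c * ∫ a, R a ∂μ) ^ 2 / ∫ a, R a ∂μ := by positivity
    have hexp : ((∫ a, M j a ∂μ) - c * ∫ a, R a ∂μ) ^ 2 / ∫ a, R a ∂μ =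
        (∫ a, M j a ∂μ) * (∫ a, M j a ∂μ) / (∫ a, R a ∂μ) - 2 * c * (∫ a, M j a ∂μ) + c ^ 2 * ∫ a, R a ∂μ := by
      field_simp
      ring
    rw [hexp] at key
    linarith

end Fluct

/-! ## §4 Positive semidefinite symmetric `3 × 3` arrays -/

/-- For a symmetric array with nonnegative quadratic form, `|D_jk| ≤ (D_jj + D_kk)/2` (test the form on
`eⱼ ± eₖ`). [folklore] -/
theorem abs_offDiag_le {D : Fin 3 → Fin 3 → ℝ} (hsymm : ∀ j k, D j k = D k j)
    (hpsd : ∀ ξ : Fin 3 → ℝ, 0 ≤ ∑ j, ∑ k, ξ j * ξ k * D j k) (j k : Fin 3) :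
    |D j k| ≤ (D j j + D k k) / 2 := by
  by_cases hjk : j = k
  · subst hjk
    have h := hpsd (fun i => if i = j then 1 else 0)
    have e : ∑ x, ∑ y, (if x = j then (1 : ℝ) else 0) * (if y = j then (1 : ℝ) else 0) * D x y = D j j := by
      rw [Finset.sum_eq_single j]
      · rw [Finset.sum_eq_single j]
        · simp
        · intro y _ hy; simp [hy]
        · simp
      · intro x _ hx; exact Finset.sum_eq_zero fun y _ => by simp [hx]
      · simp
    rw [e] at h
    rw [abs_of_nonneg h]
    linarith
  · have hplus := hpsd (fun i => if i = j then 1 else if i = k then 1 else 0)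
    have hminus := hpsd (fun i => if i = j then 1 else if i = k then -1 else 0)
    have hkj : k ≠ j := fun h => hjk h.symm
    have expand : ∀ (s : ℝ), ∑ x, ∑ y, (if x = j then (1 : ℝ) else if x = k then s else 0) *
        (if y = j then (1 : ℝ) else if y = k then s else 0) * D x y = D j j + s * D j k + s * D k j + s * s * D k k := by
      intro s
      rw [Finset.sum_eq_add_of_mem j k (Finset.mem_univ j) (Finset.mem_univ k) hjk]
      · rw [Finset.sum_eq_add_of_mem j k (Finset.mem_univ j) (Finset.mem_univ k) hjk,
          Finset.sum_eq_add_of_mem j k (Finset.mem_univ j) (Finset.mem_univ k) hjk]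
        · simp only [if_true, if_neg hkj]
          ring
        · intro y _ hy
          simp only [if_neg hy.1, if_neg hy.2, if_true, if_neg hkj]; ring
        · intro y _ hy
          simp only [if_neg hy.1, if_neg hy.2, if_true]; ring
      · intro x _ hx
        refine Finset.sum_eq_zero fun y _ => ?_
        simp only [if_neg hx.1, if_neg hx.2]; ring
    rw [expand 1] at hplus
    rw [expand (-1)] at hminus
    rw [hsymm k j] at hplus hminus
    rw [abs_le]
    constructor <;> nlinarith

/-- For a symmetric array with nonnegative quadratic form, `Σⱼₖ |D_jk| ≤ 3 Σⱼ D_jj`. [folklore] -/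
theorem sum_abs_le_three_mul_trace {D : Fin 3 → Fin 3 → ℝ} (hsymm : ∀ j k, D j k = D k j)
    (hpsd : ∀ ξ : Fin 3 → ℝ, 0 ≤ ∑ j, ∑ k, ξ j * ξ k * D j k) :
    ∑ j, ∑ k, |D j k| ≤ 3 * ∑ j, D j j := by
  calc ∑ j, ∑ k, |D j k| ≤ ∑ j, ∑ k, (D j j + D k k) / 2 :=
        Finset.sum_le_sum fun j _ => Finset.sum_le_sum fun k _ => abs_offDiag_le hsymm hpsd j k
    _ = 3 * ∑ j, D j j := by
        simp only [Fin.sum_univ_three]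
        ring

/-! ## §5 The exact window-to-cone identity -/

/-- **The window-to-cone identity** `∫ (Eⱼₖ − MⱼMₖ/R) = (Ēⱼₖ − M̄ⱼM̄ₖ/R̄) − (∫MⱼMₖ/R − M̄ⱼM̄ₖ/R̄)`: the
time-integrated same-time central stress of a window is its window covariance minus the bulk-velocity
fluctuation. [folklore] -/
theorem integral_stress_eq {R : α → ℝ} {Mj Mk Ejk : α → ℝ} (hE : Integrable Ejk μ)
    (hMM : Integrable (fun a => Mj a * Mk a / R a) μ) :
    ∫ a, (Ejk a - Mj a * Mk a / R a) ∂μ =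
      ((∫ a, Ejk a ∂μ) - (∫ a, Mj a ∂μ) * (∫ a, Mk a ∂μ) / ∫ a, R a ∂μ) -
        ((∫ a, Mj a * Mk a / R a ∂μ) - (∫ a, Mj a ∂μ) * (∫ a, Mk a ∂μ) / ∫ a, R a ∂μ) := by
  rw [integral_sub hE hMM]
  ring

/-! ## §6 Traceless contractions and the deviator -/

/-- For a traceless `a`, `Σ aⱼₖ Cⱼₖ = Σ aⱼₖ (Cⱼₖ − δⱼₖ tr C/3)`. [folklore] -/
theorem traceless_contraction_eq {a C : Fin 3 → Fin 3 → ℝ} (htr : ∑ j, a j j = 0) :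
    ∑ j, ∑ k, a j k * C j k = ∑ j, ∑ k, a j k * (C j k - if j = k then (∑ l, C l l) / 3 else 0) := by
  have h : ∑ j, ∑ k, a j k * (if j = k then (∑ l, C l l) / 3 else 0) = 0 := by
    have : ∑ j, ∑ k, a j k * (if j = k then (∑ l, C l l) / 3 else 0) = ∑ j, a j j * ((∑ l, C l l) / 3) := by
      refine Finset.sum_congr rfl fun j _ => ?_
      simp only [mul_ite, mul_zero, Finset.sum_ite_eq, Finset.mem_univ, if_true]
    rw [this, ← Finset.sum_mul, htr, zero_mul]
  have h2 : ∑ j, ∑ k, a j k * (C j k - if j = k then (∑ l, C l l) / 3 else 0) =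
      (∑ j, ∑ k, a j k * C j k) - ∑ j, ∑ k, a j k * (if j = k then (∑ l, C l l) / 3 else 0) := by
    rw [← Finset.sum_sub_distrib]
    refine Finset.sum_congr rfl fun j _ => ?_
    rw [← Finset.sum_sub_distrib]
    refine Finset.sum_congr rfl fun k _ => ?_
    ring
  rw [h2, h, sub_zero]

/-- **Traceless tests see only the deviator**: `|Σ aⱼₖ Cⱼₖ| ≤ A · Σⱼₖ |Cⱼₖ − δⱼₖ tr C/3|` whenever `Σ aⱼⱼ = 0`
and `|aⱼₖ| ≤ A`. [folklore] -/
theorem abs_traceless_contraction_le {a C : Fin 3 → Fin 3 → ℝ} (htr : ∑ j, a j j = 0) {A : ℝ}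
    (hA : ∀ j k, |a j k| ≤ A) :
    |∑ j, ∑ k, a j k * C j k| ≤ A * ∑ j, ∑ k, |C j k - if j = k then (∑ l, C l l) / 3 else 0| := by
  rw [traceless_contraction_eq htr, Finset.mul_sum]
  refine (Finset.abs_sum_le_sum_abs _ _).trans (Finset.sum_le_sum fun j _ => ?_)
  rw [Finset.mul_sum]
  refine (Finset.abs_sum_le_sum_abs _ _).trans (Finset.sum_le_sum fun k _ => ?_)
  rw [abs_mul]
  exact mul_le_mul_of_nonneg_right (hA j k) (abs_nonneg _)

/-- A bounded test contracted with any array: `|Σ aⱼₖ Dⱼₖ| ≤ A Σ |Dⱼₖ|`. [folklore] -/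
theorem abs_contraction_le {a D : Fin 3 → Fin 3 → ℝ} {A : ℝ} (hA : ∀ j k, |a j k| ≤ A) :
    |∑ j, ∑ k, a j k * D j k| ≤ A * ∑ j, ∑ k, |D j k| := by
  rw [Finset.mul_sum]
  refine (Finset.abs_sum_le_sum_abs _ _).trans (Finset.sum_le_sum fun j _ => ?_)
  rw [Finset.mul_sum]
  refine (Finset.abs_sum_le_sum_abs _ _).trans (Finset.sum_le_sum fun k _ => ?_)
  rw [abs_mul]
  exact mul_le_mul_of_nonneg_right (hA j k) (abs_nonneg _)

/-! ## §7 Registered sub-goal -/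

/-- **Registered sub-goal `stub_stressIsotropyOfWindowCovarianceA` (helper A of
`stub_stressIsotropyOfWindowCovariance`): the weighted Cauchy–Schwarz inequality behind `D_w ⪰ 0`** — on the
time axis, for a nonnegative integrable mass profile `R` and a profile `f` vanishing on `{R = 0}`,
`(∫f)² ≤ (∫R)(∫ f²/R)`. [folklore] -/
theorem stub_stressIsotropyOfWindowCovarianceA : ∀ {μ : MeasureTheory.Measure ℝ} {f R : ℝ → ℝ}, (∀ a, 0 ≤ R a) → (∀ a, R a = 0 → f a = 0) → MeasureTheory.Integrable R μ → MeasureTheory.Integrable f μ → MeasureTheory.Integrable (fun a => f a ^ 2 / R a) μ → (∫ a, f a ∂μ) ^ 2 ≤ (∫ a, R a ∂μ) * ∫ a, f a ^ 2 / R a ∂μ :=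
  fun hR h0 hRi hfi hf2 => sq_integral_le hR h0 hRi hfi hf2

end Summit.AtomisticToContinuum.HydrodynamicLimit.Theorems.ParityBandClosureWindowToCone

end
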